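import HarnessLib
import Summits.RiemannHypothesis.RiemannHypothesis.Theorems.SignConePointwiseCertSevenFifthsData

/-!
# Route SignCone: pointwise certificate `pwCert75` — anchored grid groups, file 14

Support for the unconditional rungs of `SignConeOscillatory` / `SignConeInequality`
(items stmt-RiemannHypothesis-16302 / 16301). Anchored grid groups `(w, [u₀ < u₁ < …])` of the
certificate `pwCert75` (`2` groups, `55` two-point cells on `[177.4143, 183.0000]`, in
`2` slices) and their kernel checks with the corrected fast checker (`PWData.checkAGrid₂Z`:
`w ≤ wLoQ(u₀)` at the anchor, tables `pwCert75cs/pwCert75logs`, correction `pwCert75hl`, two-point cells), combined in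
`pwCert75_groups14`. Assembled in `SignConePointwiseCertSevenFifths.lean`.
-/

-- `Summit.RiemannHypothesis.RiemannHypothesis.…` repeats a namespace component by design (D-0017 layout).
set_option linter.dupNamespace false

noncomputable section

namespace Summit.RiemannHypothesis.RiemannHypothesis.Theorems.SignCone

open Literature.Analysis.ValidatedNumerics.Numerics Literature.NumberTheory.LFunctions

/-- Anchored grid groups, file 14 slice 0 (`1` groups, `35` cells on `[177.4143, 180.9255]`). [folklore] -/
def pwCert75G14s0 : List (ℚ × List ℚ) := [
  pwCert75Grp (32315072733227181332081281/7205759403792793600000000) [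
    726689, 727174, 727672, 728176, 728527, 728872, 729209, 729536, 729852, 730158, 730455, 730745, 731153, 731561, 731981, 732440,
    732951, 733538, 734222, 735007, 735854, 736457, 737032, 737559, 738030, 738445, 738811, 739136, 739428, 739693, 739938, 740167,
    740383, 740590, 740791, 741071]]

/-- Anchored grid groups, file 14 slice 1 (`1` groups, `20` cells on `[180.9255, 183.0000]`). [folklore] -/
def pwCert75G14s1 : List (ℚ × List ℚ) := [
  pwCert75Grp (32456220301632151566456281/7205759403792793600000000) [
    741071, 741351, 741633, 741921, 742221, 742537, 742874, 743244, 743648, 744091, 744578, 745114, 745700, 746321, 746975, 747439,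
    747896, 748335, 748748, 749130, 749568]]

/-- All anchored grid groups of file 14. [folklore] -/
def pwCert75G14 : List (ℚ × List ℚ) := pwCert75G14s0 ++ pwCert75G14s1

set_option maxHeartbeats 0 in
/-- **Kernel check of slice 0 of file 14.** [folklore] -/
theorem pwCert75G14s0_ok : (pwCert75G14s0.all (pwCert75.checkAGrid₂Z pwCert75cs pwCert75logs pwCert75fac pwCert75hl)) = true := by
  decide +kernel

set_option maxHeartbeats 0 in
/-- **Kernel check of slice 1 of file 14.** [folklore] -/
theorem pwCert75G14s1_ok : (pwCert75G14s1.all (pwCert75.checkAGrid₂Z pwCert75cs pwCert75logs pwCert75fac pwCert75hl)) = true := by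
  decide +kernel

/-- **Every group of file 14 passes the fast checker.** [folklore] -/
theorem pwCert75_groups14 : ∀ g ∈ pwCert75G14, pwCert75.checkAGrid₂Z pwCert75cs pwCert75logs pwCert75fac pwCert75hl g = true :=
  List.forall_mem_append.2 ⟨List.all_eq_true.1 pwCert75G14s0_ok, List.all_eq_true.1 pwCert75G14s1_ok⟩

end Summit.RiemannHypothesis.RiemannHypothesis.Theorems.SignCone

end
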